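import Mathlib.Analysis.SpecialFunctions.ImproperIntegrals
import Mathlib.Analysis.SpecialFunctions.Complex.LogDeriv
import Mathlib.Analysis.Calculus.ParametricIntegral
import Mathlib.Analysis.Calculus.MeanValue
import Mathlib.MeasureTheory.Integral.ExpDecay

/-!
# The exponential Frullani integral `∫₀^∞ (e^{-αt} - e^{-βt}) dt/t = log β - log α`

For complex `α, β` with positive real parts,
`∫₀^∞ (e^{-αt} - e^{-βt})/t dt = Log β - Log α` (principal logarithms). This is the classical
Frullani integral for `f = exp`; it is the computation behind the identification of the spectral
measure of the Gaussian free field in H. Duminil-Copin, K. K. Kozlowski, P. Lammers, I. Manolescu,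
arXiv:2603.06268 (2026), Part II §1.1 ("it is a simple exercise […] to check from the expression
above that `Ψ₂ = σ²Ψ₂^GFF` […] if […] the density of the first marginal of `μ` is `σ²/(2πa) da`")
and proof of Theorem 53. [DKLM2026SixVertexGFF]

Proof: differentiate under the integral sign in `β` (`∂_β = ∫₀^∞ e^{-βt} dt = 1/β`), compare with
`Log β - Log α` on the (connected) right half-plane, where both vanish at `β = α`.

* `norm_cexp_neg_sub_le` — `|e^{-αt} - e^{-βt}| ≤ |α-β| t e^{-mt}` (`m ≤ Re α, Re β`, `t ≥ 0`);
* `integrableOn_frullaniKernel`, `hasDerivAt_frullani`;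
* **`integral_frullani_cexp`**, and the real version **`integral_frullani_exp`**
  (`∫₀^∞ (e^{-at} - e^{-bt})/t dt = log(b/a)` for `a, b > 0`).

## References

* G. Boros, V. Moll, *Irresistible Integrals*, Cambridge Univ. Press (2004), §5.6 (Frullani
  integrals); folklore. H. Duminil-Copin et al., arXiv:2603.06268, Part II §1.1 and Theorem 53.
  [DKLM2026SixVertexGFF]
-/

noncomputable section

open MeasureTheory Set Filter Topology Complex

namespace Literature.Analysis.SpecialFunctions

/-- **`|e^{-αt} - e^{-βt}| ≤ |α - β| t e^{-mt}`** for `t ≥ 0` and `m ≤ Re α, Re β` (mean value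
inequality along the segment `[α, β]`). [folklore] -/
theorem norm_cexp_neg_sub_le {α β : ℂ} {m : ℝ} (hα : m ≤ α.re) (hβ : m ≤ β.re) {t : ℝ} (ht : 0 ≤ t) :
    ‖Complex.exp (-(α * t)) - Complex.exp (-(β * t))‖ ≤ ‖α - β‖ * t * Real.exp (-(m * t)) := by
  -- the half-plane `{m ≤ Re z}` is convex and contains the segment
  have hconv : Convex ℝ {z : ℂ | m ≤ z.re} := convex_halfSpace_ge Complex.reLm.isLinear m
  have hderiv : ∀ z ∈ {z : ℂ | m ≤ z.re}, HasDerivWithinAt (fun z : ℂ => Complex.exp (-(z * t)))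
      (Complex.exp (-(z * t)) * (-(t : ℂ))) {z : ℂ | m ≤ z.re} z := by
    intro z _
    exact (((hasDerivAt_id z).mul_const (t : ℂ)).neg.cexp).hasDerivWithinAt.congr_deriv (by simp)
  have hbound : ∀ z ∈ {z : ℂ | m ≤ z.re}, ‖Complex.exp (-(z * t)) * (-(t : ℂ))‖ ≤ t * Real.exp (-(m * t)) := by
    intro z hz
    rw [norm_mul, norm_neg, Complex.norm_real, Real.norm_eq_abs, abs_of_nonneg ht, Complex.norm_exp, mul_comm]
    gcongr
    simp only [neg_re, mul_re, ofReal_re, ofReal_im, mul_zero, sub_zero]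
    nlinarith [hz.out]
  have h := hconv.norm_image_sub_le_of_norm_hasDerivWithin_le hderiv hbound (show α ∈ {z : ℂ | m ≤ z.re} from hα)
    (show β ∈ {z : ℂ | m ≤ z.re} from hβ)
  rw [← norm_neg, neg_sub] at h
  calc ‖Complex.exp (-(α * t)) - Complex.exp (-(β * t))‖ ≤ t * Real.exp (-(m * t)) * ‖β - α‖ := h
    _ = ‖α - β‖ * t * Real.exp (-(m * t)) := by rw [← norm_neg (β - α), neg_sub]; ring

/-- The Frullani kernel `(e^{-αt} - e^{-βt})/t`. [folklore] -/
def frullaniKernel (α β : ℂ) (t : ℝ) : ℂ := (Complex.exp (-(α * t)) - Complex.exp (-(β * t))) / t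

/-- The kernel is continuous on `(0, ∞)`. [folklore] -/
theorem continuousOn_frullaniKernel (α β : ℂ) : ContinuousOn (frullaniKernel α β) (Ioi 0) := by
  unfold frullaniKernel
  refine ContinuousOn.div (Continuous.continuousOn (by fun_prop)) Complex.continuous_ofReal.continuousOn fun t ht => ?_
  exact_mod_cast (ne_of_gt (mem_Ioi.1 ht))

/-- The kernel is bounded by `|α-β| e^{-mt}` on `(0,∞)`. [folklore] -/
theorem norm_frullaniKernel_le {α β : ℂ} {m : ℝ} (hα : m ≤ α.re) (hβ : m ≤ β.re) {t : ℝ} (ht : 0 < t) :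
    ‖frullaniKernel α β t‖ ≤ ‖α - β‖ * Real.exp (-(m * t)) := by
  rw [frullaniKernel, norm_div, Complex.norm_real, Real.norm_eq_abs, abs_of_pos ht, div_le_iff₀ ht]
  calc _ ≤ ‖α - β‖ * t * Real.exp (-(m * t)) := norm_cexp_neg_sub_le hα hβ ht.le
    _ = ‖α - β‖ * Real.exp (-(m * t)) * t := by ring

/-- **The Frullani kernel is integrable on `(0,∞)`** for `Re α, Re β > 0`. [folklore] -/
theorem integrableOn_frullaniKernel {α β : ℂ} (hα : 0 < α.re) (hβ : 0 < β.re) :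
    IntegrableOn (frullaniKernel α β) (Ioi 0) := by
  set m : ℝ := min α.re β.re with hm
  have hm0 : 0 < m := lt_min hα hβ
  refine Integrable.mono' (((exp_neg_integrableOn_Ioi 0 hm0).const_mul ‖α - β‖))
    ((continuousOn_frullaniKernel α β).aestronglyMeasurable measurableSet_Ioi) ?_
  rw [ae_restrict_iff' measurableSet_Ioi]
  refine ae_of_all _ fun t ht => ?_
  rw [show -m * t = -(m * t) by ring]
  exact norm_frullaniKernel_le (min_le_left _ _) (min_le_right _ _) ht

/-- The exponential Frullani integral as a function of `β`. [folklore] -/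
def frullaniIntegral (α β : ℂ) : ℂ := ∫ t in Ioi (0 : ℝ), frullaniKernel α β t

/-- `∫₀^∞ e^{-βt} dt = 1/β` for `Re β > 0`. [folklore] -/
theorem integral_cexp_neg_mul_Ioi {β : ℂ} (hβ : 0 < β.re) :
    ∫ t in Ioi (0 : ℝ), Complex.exp (-(β * t)) = β⁻¹ := by
  have h := integral_exp_mul_complex_Ioi (a := -β) (by simpa using hβ) 0
  simp only [neg_mul, ofReal_zero, mul_zero, Complex.exp_zero] at h
  rw [h, neg_div_neg_eq, one_div]

/-- **Differentiation under the integral sign**: `∂_β ∫₀^∞ (e^{-αt} - e^{-βt})/t dt = 1/β`.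
[folklore] -/
theorem hasDerivAt_frullaniIntegral {α β₀ : ℂ} (hα : 0 < α.re) (hβ₀ : 0 < β₀.re) :
    HasDerivAt (frullaniIntegral α) β₀⁻¹ β₀ := by
  set r : ℝ := β₀.re with hr
  have hs : {β : ℂ | r / 2 < β.re} ∈ 𝓝 β₀ :=
    (isOpen_lt continuous_const Complex.continuous_re).mem_nhds (by show r / 2 < β₀.re; linarith)
  have hderiv : ∀ (t : ℝ), 0 < t → ∀ β : ℂ, HasDerivAt (fun β => frullaniKernel α β t) (Complex.exp (-(β * t))) β := by
    intro t ht β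
    have ht' : (t : ℂ) ≠ 0 := by exact_mod_cast ht.ne'
    have h1 : HasDerivAt (fun β : ℂ => Complex.exp (-(β * t))) (Complex.exp (-(β * t)) * (-(t : ℂ))) β :=
      (((hasDerivAt_id β).mul_const (t : ℂ)).neg.cexp).congr_deriv (by simp)
    have h2 := (h1.const_sub (Complex.exp (-(α * t)))).div_const (t : ℂ)
    refine h2.congr_deriv ?_
    field_simp
  rw [← integral_cexp_neg_mul_Ioi hβ₀]
  refine (hasDerivAt_integral_of_dominated_loc_of_deriv_le (μ := volume.restrict (Ioi (0 : ℝ)))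
    (F := fun β t => frullaniKernel α β t) (F' := fun β t => Complex.exp (-(β * t)))
    (bound := fun t => Real.exp (-(r / 2 * t))) hs
    (Eventually.of_forall fun β => (continuousOn_frullaniKernel α β).aestronglyMeasurable measurableSet_Ioi)
    (integrableOn_frullaniKernel hα hβ₀) (Continuous.aestronglyMeasurable (by fun_prop)) ?_ ?_ ?_).2
  · rw [ae_restrict_iff' measurableSet_Ioi]
    refine ae_of_all _ fun t (ht : 0 < t) β (hβ : r / 2 < β.re) => ?_
    rw [Complex.norm_exp]
    apply Real.exp_le_exp.2
    simp only [neg_re, mul_re, ofReal_re, ofReal_im, mul_zero, sub_zero]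
    nlinarith
  · have := exp_neg_integrableOn_Ioi 0 (show 0 < r / 2 by positivity)
    refine this.congr_fun (fun t _ => by ring_nf) measurableSet_Ioi
  · rw [ae_restrict_iff' measurableSet_Ioi]
    exact ae_of_all _ fun t ht β _ => hderiv t ht β

/-- **The exponential Frullani integral**: for `Re α, Re β > 0`,
`∫₀^∞ (e^{-αt} - e^{-βt})/t dt = Log β - Log α`. [folklore] -/
theorem integral_frullani_cexp {α β : ℂ} (hα : 0 < α.re) (hβ : 0 < β.re) :
    ∫ t in Ioi (0 : ℝ), (Complex.exp (-(α * t)) - Complex.exp (-(β * t))) / t = Complex.log β - Complex.log α := by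
  have hS : IsOpen {β : ℂ | 0 < β.re} := isOpen_lt continuous_const Complex.continuous_re
  have hconn : IsPreconnected {β : ℂ | 0 < β.re} := (convex_halfSpace_gt Complex.reLm.isLinear 0).isPreconnected
  have hF : DifferentiableOn ℂ (frullaniIntegral α) {β : ℂ | 0 < β.re} := fun β hβ =>
    (hasDerivAt_frullaniIntegral hα hβ).differentiableAt.differentiableWithinAt
  have hslit : ∀ β : ℂ, 0 < β.re → β ∈ Complex.slitPlane := fun β hβ => Complex.mem_slitPlane_iff.2 (Or.inl hβ)
  have hG : DifferentiableOn ℂ (fun β => Complex.log β - Complex.log α) {β : ℂ | 0 < β.re} := fun β hβ =>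
    ((Complex.hasDerivAt_log (hslit β hβ)).differentiableAt.sub_const _).differentiableWithinAt
  have hderiv : EqOn (deriv (frullaniIntegral α)) (deriv fun β => Complex.log β - Complex.log α) {β : ℂ | 0 < β.re} := by
    intro β hβ
    rw [(hasDerivAt_frullaniIntegral hα hβ).deriv, ((Complex.hasDerivAt_log (hslit β hβ)).sub_const _).deriv]
  have h0 : frullaniIntegral α α = (fun β => Complex.log β - Complex.log α) α := by
    simp [frullaniIntegral, frullaniKernel]
  have := hS.eqOn_of_deriv_eq hconn hF hG hderiv hα h0 hβ
  simpa [frullaniIntegral, frullaniKernel] using this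

/-- **The real exponential Frullani integral**: for `0 < a, b`,
`∫₀^∞ (e^{-at} - e^{-bt})/t dt = log(b/a)`. [folklore] -/
theorem integral_frullani_exp {a b : ℝ} (ha : 0 < a) (hb : 0 < b) :
    ∫ t in Ioi (0 : ℝ), (Real.exp (-(a * t)) - Real.exp (-(b * t))) / t = Real.log (b / a) := by
  have h := integral_frullani_cexp (α := a) (β := b) (by simpa using ha) (by simpa using hb)
  have hfun : (fun t : ℝ => (Complex.exp (-((a : ℂ) * t)) - Complex.exp (-((b : ℂ) * t))) / t) =
      fun t : ℝ => (((Real.exp (-(a * t)) - Real.exp (-(b * t))) / t : ℝ) : ℂ) := by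
    funext t; push_cast; ring_nf
  have hof : (∫ t in Ioi (0 : ℝ), (((Real.exp (-(a * t)) - Real.exp (-(b * t))) / t : ℝ) : ℂ)) =
      ((∫ t in Ioi (0 : ℝ), (Real.exp (-(a * t)) - Real.exp (-(b * t))) / t : ℝ) : ℂ) := integral_ofReal
  rw [hfun, hof, ← Complex.ofReal_log hb.le, ← Complex.ofReal_log ha.le, ← Complex.ofReal_sub,
    Complex.ofReal_inj] at h
  rw [h, Real.log_div hb.ne' ha.ne']

end Literature.Analysis.SpecialFunctions

end
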